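import Literature.Analysis.FluidPDE.ElgindiThetaDerivativeOperator
import HarnessLib

/-!
# `D_z` applied to Elgindi's operator `𝓛_Γ^T`: the seven-term commutation formula
([Elgindi2021] §6.2, proof of Proposition 6.9, first half)

Topic `Literature/Analysis/FluidPDE`. Proof file (everything proved, no definitions, no named
facts) on the proof path of the named fact
`Literature.Analysis.FluidPDE.Elgindi.ElgindiGhoulMasmoudi2021_stabilityCore`
(`ElgindiStabilityDecomposition.lean`). T. M. Elgindi, Ann. of Math. 194 (2021) =
arXiv:1904.04795 (`[Elgindi2021]`), §6.2 "`L²` coercivity for `𝓛_Γ^T` with one `z`-derivative",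
proof of **Proposition 6.9** (p. 17 of the held text):

> "`D_z𝓛_Γ^T(f) = 𝓛(D_z(f)) + (2z/(1+z)²)f − D_z((2Γz/(c(1+z)²))L₁₂(f)) − 3D_zℙ((1/(1+z))sin(2θ)∂_θf)
> = 𝓛(D_z(f)) + (2z/(1+z)²)f + (2Γz/(c(1+z)²))(K, f(z,θ))_{L²_θ} − 2(Γz(1−z)/(c(1+z)³))L₁₂(f) +
> (3z/(1+z)²)D_θf − (3/(1+z))sin(2θ)∂_θD_zf + 3D_z((Γ/c)(2z²/(1+z)³)L₁₂((1/(1+z))sin(2θ)∂_θf)(0))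
> = Σ_{i=1}^7 I_i`."

(`D_z = z∂_z`, `D_θ = sin(2θ)∂_θ`, `(K, f)_{L²_θ} = ∫₀^{π/2}Kf dθ = Elgindi.kMoment f`,
`D_z L₁₂(f) = −(K,f)_{L²_θ}`.) This file proves exactly this identity on the open strip
(`Dz_opLΓT`), for `f ∈ C²` compactly supported inside the open strip (the compact support makes
`L₁₂(f)` differentiable with `(L₁₂f)' = −z⁻¹∫Kf dθ`, `ElgindiL12Calculus.lean`), with the last
term written out: `3D_z((Γ/c)(2z²/(1+z)³))·L₁₂((1/(1+z))D_θf)(0) = (Γ/c)(2z²(2−z)/(1+z)⁴)·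
L₁₂((3/(1+z))D_θf)(0)`, and `D_zD_θ = D_θD_z` (`Dθ_Dz_comm`). Also: the regularity of `D_zf`
(`Cⁿ`, compactly supported inside the strip, for `f ∈ C^{n+1}`), `D_z𝓛(f) = 𝓛(D_zf) + (2z/(1+z)²)f`
(`Dz_opL`), and the radial constant `∫₀^∞(2−z)²/(1+z)⁴ dz = 1` of the `I₇` bound.

The pairing estimates (the displayed bounds on `I₂, …, I₇`) and Prop. 6.9 itself are in the next file.
-/

noncomputable section

open MeasureTheory Set Function Real Filter
open _root_.Topology

namespace Literature.Analysis.FluidPDE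

namespace Elgindi

/-! ### `D_z f` of a test function -/

/-- `D_z f` vanishes off the support of `f`. [folklore] -/
theorem Dz_eq_zero_of_notMem_tsupport {f : ℝ → ℝ → ℝ} {p : ℝ × ℝ} (hp : p ∉ tsupport (uncurry f)) :
    Dz f p.1 p.2 = 0 := by
  have : dz f p.1 p.2 = 0 := deriv_slice_fst_eq_zero_of_notMem_tsupport (F := uncurry f) hp
  rw [Dz_eq_mul_dz, this, mul_zero]

/-- `D_z f` is supported inside the support of `f`. [folklore] -/
theorem tsupport_Dz_subset {f : ℝ → ℝ → ℝ} : tsupport (uncurry (Dz f)) ⊆ tsupport (uncurry f) := by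
  refine closure_minimal (fun p hp => ?_) (isClosed_tsupport _)
  by_contra h
  exact hp (Dz_eq_zero_of_notMem_tsupport (p := p) h)

/-- For `f ∈ C^{n+1}` compactly supported inside the open strip, `D_z f` is `Cⁿ` on the plane. [folklore] -/
theorem contDiff_Dz {f : ℝ → ℝ → ℝ} {n : ℕ} (hf : ContDiff ℝ (n + 1) (uncurry f))
    (hsub : tsupport (uncurry f) ⊆ strip) : ContDiff ℝ n (uncurry (Dz f)) :=
  contDiff_of_contDiffOn_strip (contDiffOn_Dz (n := n) (by exact_mod_cast hf.contDiffOn))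
    (tsupport_Dz_subset.trans hsub)

/-- `D_z f` of a compactly supported `f` is compactly supported. [folklore] -/
theorem hasCompactSupport_Dz {f : ℝ → ℝ → ℝ} (hs : HasCompactSupport (uncurry f)) :
    HasCompactSupport (uncurry (Dz f)) :=
  hs.mono' ((subset_tsupport _).trans tsupport_Dz_subset)

/-! ### Slice derivatives in `z` -/

/-- The `z`-slice of a `C¹` function on the strip has derivative `∂_z` there. [folklore] -/
theorem hasDerivAt_slice_fst_dz {F : ℝ → ℝ → ℝ} (hF : ContDiffOn ℝ 1 (uncurry F) strip) {p : ℝ × ℝ}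
    (hp : p ∈ strip) : HasDerivAt (fun z => F z p.2) (dz F p.1 p.2) p.1 := by
  have hd := differentiableAt_of_contDiffOn_strip hF one_ne_zero hp
  rw [dz_eq_fderiv hd]
  exact hasDerivAt_slice_fst hd

/-- **`D_z𝓛(f) = 𝓛(D_zf) + (2z/(1+z)²)f`** on the open strip for `f ∈ C²(strip)` (the terms `I₁ + I₂`). [cite: Elgindi2021, §6.2, proof of Proposition 6.9 (p. 17 of arXiv:1904.04795)] -/
theorem Dz_opL {f : ℝ → ℝ → ℝ} (hf : ContDiffOn ℝ 2 (uncurry f) strip) {p : ℝ × ℝ} (hp : p ∈ strip) :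
    Dz (opL f) p.1 p.2 = opL (Dz f) p.1 p.2 + 2 * p.1 / (1 + p.1) ^ 2 * f p.1 p.2 := by
  have hz1 : (1 : ℝ) + p.1 ≠ 0 := by have : (0 : ℝ) < p.1 := hp.1; positivity
  have h1 : ContDiffOn ℝ 1 (uncurry (dz f)) strip := contDiffOn_dz (n := 1) hf
  have hfd : HasDerivAt (fun z => f z p.2) (dz f p.1 p.2) p.1 := hasDerivAt_slice_fst_dz (hf.of_le (by norm_num)) hp
  have hdzd : HasDerivAt (fun z => dz f z p.2) (dz (dz f) p.1 p.2) p.1 := hasDerivAt_slice_fst_dz h1 hp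
  have hden : HasDerivAt (fun z : ℝ => 1 + z) 1 p.1 := by simpa using (hasDerivAt_id' p.1).const_add 1
  -- the slice of `𝓛 f`
  have e : (fun z => opL f z p.2) = fun z => (f z p.2 + z * dz f z p.2) - 2 * f z p.2 / (1 + z) := by
    funext z
    simp only [opL_apply, Dz_eq_mul_dz]
  have h := (hfd.fun_add ((hasDerivAt_id' p.1).fun_mul hdzd)).fun_sub ((hfd.const_mul 2).fun_div hden hz1)
  rw [Dz_eq_mul_dz, dz, e, h.deriv, opL_apply]
  -- `D_z(D_z f)`: the slice of `z∂_z f`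
  have hDz : Dz (Dz f) p.1 p.2 = p.1 * (1 * dz f p.1 p.2 + p.1 * dz (dz f) p.1 p.2) := by
    rw [Dz_eq_mul_dz (Dz f), dz]
    have e2 : (fun z' => Dz f z' p.2) = fun z' => z' * dz f z' p.2 := by funext z'; rw [Dz_eq_mul_dz]
    rw [e2, ((hasDerivAt_id' p.1).fun_mul hdzd).deriv]
  rw [hDz, Dz_eq_mul_dz f]
  field_simp
  ring

/-- **The commutation formula for `D_z𝓛_Γ^T` (the seven terms `I₁, …, I₇`)** on the open strip,
for `f ∈ C²` compactly supported inside the open strip and `α ≥ 0` (so that `c > 0`):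
`D_z(𝓛_Γ^Tf) = 𝓛(D_zf) + (2z/(1+z)²)f + (2zΓ/(c(1+z)²))(K,f)_θ − (2z(1−z)Γ/(c(1+z)³))L₁₂(f) +
(3z/(1+z)²)D_θf − (3/(1+z))D_θ(D_zf) + L₁₂((3/(1+z))D_θf)(0)·(Γ/c)(2z²(2−z)/(1+z)⁴)` (Elgindi 2021,
proof of Prop. 6.9, the display "`D_z𝓛_Γ^T(f) = … = Σ_{i=1}^7 I_i`"). [cite: Elgindi2021, §6.2, proof of Proposition 6.9 (p. 17 of arXiv:1904.04795)] -/
theorem Dz_opLΓT {α : ℝ} (hα : 0 ≤ α) {f : ℝ → ℝ → ℝ} (hf : ContDiff ℝ 2 (uncurry f))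
    (hs : HasCompactSupport (uncurry f)) (hsub : tsupport (uncurry f) ⊆ strip) {p : ℝ × ℝ}
    (hp : p ∈ strip) :
    Dz (opLΓT α f) p.1 p.2 =
      opL (Dz f) p.1 p.2 + 2 * p.1 / (1 + p.1) ^ 2 * f p.1 p.2
        + 2 * p.1 * angularWeight α p.2 / (profileConst α * (1 + p.1) ^ 2) * kMoment f p.1
        - 2 * p.1 * (1 - p.1) * angularWeight α p.2 / (profileConst α * (1 + p.1) ^ 3) * L12 f p.1
        + 3 * p.1 / (1 + p.1) ^ 2 * Dθ f p.1 p.2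
        - 3 / (1 + p.1) * Dθ (Dz f) p.1 p.2
        + L12 (fun z θ => 3 / (1 + z) * Dθ f z θ) 0 *
          (angularWeight α p.2 / profileConst α * (2 * p.1 ^ 2 * (2 - p.1) / (1 + p.1) ^ 4)) := by
  set ℓ₀ : ℝ := L12 (fun z θ => 3 / (1 + z) * Dθ f z θ) 0 with hℓ₀
  have hz0 : (0 : ℝ) < p.1 := hp.1
  have hz : (p.1 : ℝ) ≠ 0 := hz0.ne'
  have hz1 : (1 : ℝ) + p.1 ≠ 0 := by positivity
  have hf2 : ContDiffOn ℝ 2 (uncurry f) strip := hf.contDiffOn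
  have hc : profileConst α ≠ 0 := (profileConst_pos hα).ne'
  -- the four `z`-slices and their derivatives at `p.1`
  have hopL1 : ContDiffOn ℝ 1 (uncurry (opL f)) strip := by
    have h1 : ContDiffOn ℝ 1 (uncurry f) strip := hf2.of_le (by norm_num)
    have h2 : ContDiffOn ℝ 1 (uncurry (Dz f)) strip := contDiffOn_Dz (n := 1) hf2
    have h3 : ContDiffOn ℝ 1 (fun q : ℝ × ℝ => 2 * f q.1 q.2 / (1 + q.1)) strip :=
      (contDiffOn_const.mul h1).div (by fun_prop) fun q hq => by
        have : (0 : ℝ) < q.1 := hq.1; positivity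
    exact ((h1.add h2).sub h3).congr fun q _ => by
      simp only [Function.uncurry, opL_apply]
  have hopL : HasDerivAt (fun z => opL f z p.2) (deriv (fun z => opL f z p.2) p.1) p.1 :=
    (hasDerivAt_slice_fst (differentiableAt_of_contDiffOn_strip hopL1 one_ne_zero hp)).differentiableAt.hasDerivAt
  have hLd : HasDerivAt (L12 f) (-(kMoment f p.1 / p.1)) p.1 := hasDerivAt_L12 hf.continuous hs hsub p.1
  have hden : HasDerivAt (fun z : ℝ => 1 + z) 1 p.1 := by simpa using (hasDerivAt_id' p.1).const_add 1
  have hrat2 : HasDerivAt (fun z : ℝ => z / (1 + z) ^ 2)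
      ((1 * (1 + p.1) ^ 2 - p.1 * (2 * (1 + p.1) * 1)) / ((1 + p.1) ^ 2) ^ 2) p.1 := by
    have h2 : HasDerivAt (fun z : ℝ => (1 + z) ^ 2) (2 * (1 + p.1) * 1) p.1 := by
      simpa using hden.fun_pow 2
    exact (hasDerivAt_id' p.1).div h2 (pow_ne_zero 2 hz1)
  have hT2 : HasDerivAt (fun z => 2 * z * angularWeight α p.2 / (profileConst α * (1 + z) ^ 2) * L12 f z)
      ((2 * angularWeight α p.2 / profileConst α) *
        ((1 * (1 + p.1) ^ 2 - p.1 * (2 * (1 + p.1) * 1)) / ((1 + p.1) ^ 2) ^ 2) * L12 f p.1 +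
        (2 * angularWeight α p.2 / profileConst α) * (p.1 / (1 + p.1) ^ 2) * (-(kMoment f p.1 / p.1))) p.1 := by
    have h := (hrat2.const_mul (2 * angularWeight α p.2 / profileConst α)).fun_mul hLd
    have e : (fun z => 2 * z * angularWeight α p.2 / (profileConst α * (1 + z) ^ 2) * L12 f z) =
        fun z => 2 * angularWeight α p.2 / profileConst α * (z / (1 + z) ^ 2) * L12 f z := by
      funext z
      rw [div_mul_div_comm]
      ring
    rw [e]
    exact h
  have h1θ : ContDiffOn ℝ 1 (uncurry (Dθ f)) strip := contDiffOn_Dθ (n := 1) hf2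
  have hDθd : HasDerivAt (fun z => Dθ f z p.2) (dz (Dθ f) p.1 p.2) p.1 := hasDerivAt_slice_fst_dz h1θ hp
  have hT3 : HasDerivAt (fun z => 3 / (1 + z) * Dθ f z p.2)
      (3 * (-1 / (1 + p.1) ^ 2) * Dθ f p.1 p.2 + 3 * (1 + p.1)⁻¹ * dz (Dθ f) p.1 p.2) p.1 := by
    have hinv : HasDerivAt (fun z : ℝ => 3 * (1 + z)⁻¹) (3 * (-1 / (1 + p.1) ^ 2)) p.1 :=
      (hden.fun_inv hz1).const_mul 3
    have e3 : (fun z => 3 / (1 + z) * Dθ f z p.2) = fun z => 3 * (1 + z)⁻¹ * Dθ f z p.2 := by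
      funext z
      rw [div_eq_mul_inv]
    rw [e3]
    exact hinv.fun_mul hDθd
  have hrat4 : HasDerivAt (fun z : ℝ => 2 * z ^ 2 / (1 + z) ^ 3)
      ((2 * (2 * p.1 ^ (2 - 1) * 1) * (1 + p.1) ^ 3 - 2 * p.1 ^ 2 * (3 * (1 + p.1) ^ 2 * 1)) /
        ((1 + p.1) ^ 3) ^ 2) p.1 := by
    have hnum : HasDerivAt (fun z : ℝ => 2 * z ^ 2) (2 * (2 * p.1 ^ (2 - 1) * 1)) p.1 := by
      simpa using ((hasDerivAt_id' p.1).fun_pow 2).const_mul 2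
    have hden3 : HasDerivAt (fun z : ℝ => (1 + z) ^ 3) (3 * (1 + p.1) ^ 2 * 1) p.1 := by
      simpa using hden.fun_pow 3
    exact hnum.div hden3 (pow_ne_zero 3 hz1)
  have hT4 : HasDerivAt (fun z => projKernel α z p.2 * ℓ₀)
      (angularWeight α p.2 / profileConst α *
        ((2 * (2 * p.1 ^ (2 - 1) * 1) * (1 + p.1) ^ 3 - 2 * p.1 ^ 2 * (3 * (1 + p.1) ^ 2 * 1)) /
          ((1 + p.1) ^ 3) ^ 2) * ℓ₀) p.1 := by
    have h := (hrat4.const_mul (angularWeight α p.2 / profileConst α)).mul_const ℓ₀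
    have e : (fun z => projKernel α z p.2 * ℓ₀) =
        fun z => angularWeight α p.2 / profileConst α * (2 * z ^ 2 / (1 + z) ^ 3) * ℓ₀ := by
      funext z; simp only [projKernel]
    rw [e]
    exact h
  -- the slice of `𝓛_Γ^T f` and its derivative
  have e : (fun z => opLΓT α f z p.2) = fun z => ((opL f z p.2 -
      2 * z * angularWeight α p.2 / (profileConst α * (1 + z) ^ 2) * L12 f z) -
      3 / (1 + z) * Dθ f z p.2) + projKernel α z p.2 * ℓ₀ := by
    funext z
    simp only [opLΓT_apply, opLΓ_apply, projP, hℓ₀]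
    ring
  have hmain := ((hopL.fun_sub hT2).fun_sub hT3).fun_add hT4
  rw [Dz_eq_mul_dz (opLΓT α f), dz, e, hmain.deriv]
  -- evaluate `deriv (slice of 𝓛 f)` through `Dz_opL`, and `D_zD_θ = D_θD_z`
  have d1 : p.1 * deriv (fun z => opL f z p.2) p.1 = opL (Dz f) p.1 p.2 + 2 * p.1 / (1 + p.1) ^ 2 * f p.1 p.2 := by
    rw [← dz, ← Dz_eq_mul_dz]
    exact Dz_opL hf2 hp
  have d3 : p.1 * dz (Dθ f) p.1 p.2 = Dθ (Dz f) p.1 p.2 := by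
    rw [← Dz_eq_mul_dz, ← Dθ_Dz_comm hf2 hp]
  -- algebra
  have key : p.1 * (deriv (fun z => opL f z p.2) p.1 -
      ((2 * angularWeight α p.2 / profileConst α) *
        ((1 * (1 + p.1) ^ 2 - p.1 * (2 * (1 + p.1) * 1)) / ((1 + p.1) ^ 2) ^ 2) * L12 f p.1 +
        (2 * angularWeight α p.2 / profileConst α) * (p.1 / (1 + p.1) ^ 2) * (-(kMoment f p.1 / p.1))) -
      (3 * (-1 / (1 + p.1) ^ 2) * Dθ f p.1 p.2 + 3 * (1 + p.1)⁻¹ * dz (Dθ f) p.1 p.2) +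
      angularWeight α p.2 / profileConst α *
        ((2 * (2 * p.1 ^ (2 - 1) * 1) * (1 + p.1) ^ 3 - 2 * p.1 ^ 2 * (3 * (1 + p.1) ^ 2 * 1)) /
          ((1 + p.1) ^ 3) ^ 2) * ℓ₀) =
      p.1 * deriv (fun z => opL f z p.2) p.1
        + 2 * p.1 * angularWeight α p.2 / (profileConst α * (1 + p.1) ^ 2) * kMoment f p.1
        - 2 * p.1 * (1 - p.1) * angularWeight α p.2 / (profileConst α * (1 + p.1) ^ 3) * L12 f p.1
        + 3 * p.1 / (1 + p.1) ^ 2 * Dθ f p.1 p.2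
        - 3 / (1 + p.1) * (p.1 * dz (Dθ f) p.1 p.2)
        + ℓ₀ * (angularWeight α p.2 / profileConst α * (2 * p.1 ^ 2 * (2 - p.1) / (1 + p.1) ^ 4)) := by
    field_simp
    ring
  rw [key, d1, d3]

/-! ### The radial constant of the `I₇` bound -/

/-- `∫₀^∞ (2−z)²/(1+z)⁴ dz = 1` (`(2−z)² = 9 − 6(1+z) + (1+z)²`; antiderivative
`−3(1+z)⁻³ + 3(1+z)⁻² − (1+z)⁻¹`). [folklore] -/
theorem integral_Ioi_sq_two_sub_div_pow_four : ∫ z in Ioi (0 : ℝ), (2 - z) ^ 2 / (1 + z) ^ 4 = 1 := by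
  have hd : ∀ z ∈ Ici (0 : ℝ), HasDerivAt (fun z : ℝ => -3 * ((1 + z) ^ 3)⁻¹ + 3 * ((1 + z) ^ 2)⁻¹ - (1 + z)⁻¹)
      ((2 - z) ^ 2 / (1 + z) ^ 4) z := by
    intro z hz
    have hz1 : (1 + z) ≠ 0 := by have : (0 : ℝ) ≤ z := hz; positivity
    have h1 : HasDerivAt (fun z : ℝ => 1 + z) 1 z := by simpa using (hasDerivAt_id' z).const_add 1
    have hp : ∀ n : ℕ, HasDerivAt (fun z : ℝ => ((1 + z) ^ n)⁻¹)
        (-(↑n * (1 + z) ^ (n - 1) * 1) / ((1 + z) ^ n) ^ 2) z := fun n =>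
      (h1.fun_pow n).fun_inv (pow_ne_zero n hz1)
    have h := (((hp 3).const_mul (-3)).add ((hp 2).const_mul 3)).sub (h1.fun_inv hz1)
    refine h.congr_deriv ?_
    push_cast
    field_simp
    ring
  have ht : Tendsto (fun z : ℝ => 1 + z) atTop atTop := tendsto_atTop_add_const_left _ 1 tendsto_id
  have hl : ∀ n : ℕ, n ≠ 0 → Tendsto (fun z : ℝ => ((1 + z) ^ n)⁻¹) atTop (𝓝 0) := fun n hn =>
    tendsto_inv_atTop_zero.comp ((tendsto_pow_atTop hn).comp ht)
  have hl1 : Tendsto (fun z : ℝ => (1 + z)⁻¹) atTop (𝓝 0) := tendsto_inv_atTop_zero.comp ht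
  have hlim : Tendsto (fun z : ℝ => -3 * ((1 + z) ^ 3)⁻¹ + 3 * ((1 + z) ^ 2)⁻¹ - (1 + z)⁻¹) atTop (𝓝 0) := by
    have h := (((hl 3 (by norm_num)).const_mul (-3)).add ((hl 2 (by norm_num)).const_mul 3)).sub hl1
    convert h using 2
    norm_num
  rw [integral_Ioi_of_hasDerivAt_of_nonneg' hd (fun z hz => by
    have : (0 : ℝ) < z := hz; positivity) hlim]
  norm_num

/-- `(2−z)²/(1+z)⁴` is integrable on `(0, ∞)`. [folklore] -/
theorem integrableOn_sq_two_sub_div_pow_four : IntegrableOn (fun z : ℝ => (2 - z) ^ 2 / (1 + z) ^ 4) (Ioi 0) := by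
  have hd : ∀ z ∈ Ici (0 : ℝ), HasDerivAt (fun z : ℝ => -3 * ((1 + z) ^ 3)⁻¹ + 3 * ((1 + z) ^ 2)⁻¹ - (1 + z)⁻¹)
      ((2 - z) ^ 2 / (1 + z) ^ 4) z := by
    intro z hz
    have hz1 : (1 + z) ≠ 0 := by have : (0 : ℝ) ≤ z := hz; positivity
    have h1 : HasDerivAt (fun z : ℝ => 1 + z) 1 z := by simpa using (hasDerivAt_id' z).const_add 1
    have hp : ∀ n : ℕ, HasDerivAt (fun z : ℝ => ((1 + z) ^ n)⁻¹)
        (-(↑n * (1 + z) ^ (n - 1) * 1) / ((1 + z) ^ n) ^ 2) z := fun n =>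
      (h1.fun_pow n).fun_inv (pow_ne_zero n hz1)
    have h := (((hp 3).const_mul (-3)).add ((hp 2).const_mul 3)).sub (h1.fun_inv hz1)
    refine h.congr_deriv ?_
    push_cast
    field_simp
    ring
  have ht : Tendsto (fun z : ℝ => 1 + z) atTop atTop := tendsto_atTop_add_const_left _ 1 tendsto_id
  have hl : ∀ n : ℕ, n ≠ 0 → Tendsto (fun z : ℝ => ((1 + z) ^ n)⁻¹) atTop (𝓝 0) := fun n hn =>
    tendsto_inv_atTop_zero.comp ((tendsto_pow_atTop hn).comp ht)
  have hl1 : Tendsto (fun z : ℝ => (1 + z)⁻¹) atTop (𝓝 0) := tendsto_inv_atTop_zero.comp ht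
  have hlim : Tendsto (fun z : ℝ => -3 * ((1 + z) ^ 3)⁻¹ + 3 * ((1 + z) ^ 2)⁻¹ - (1 + z)⁻¹) atTop (𝓝 0) := by
    have h := (((hl 3 (by norm_num)).const_mul (-3)).add ((hl 2 (by norm_num)).const_mul 3)).sub hl1
    convert h using 2
    norm_num
  exact integrableOn_Ioi_deriv_of_nonneg' hd (fun z hz => by
    have : (0 : ℝ) < z := hz; positivity) hlim

end Elgindi

end Literature.Analysis.FluidPDE
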